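import Mathlib.Topology.Homotopy.Lifting
import HarnessLib

/-!
# A connected covering of a simply connected space is a homeomorphism

The step "`Φ : Σ̃ → ℝ³` is a covering, `ℝ³` is simply connected, hence `Φ` is a bijection and
`Σ̃ ≈ ℝ³`" of the proof of the rigid positive energy theorem (Beig–Chruściel, J. Math. Phys. 37
(1996), §4; Chruściel [C3]) is the classical fact (Hatcher 2002, Prop. 1.39 / exercise: a simply
connected, locally path connected space has no non-trivial connected coverings):

* `IsCoveringMap.bijective_of_simplyConnectedSpace` — a covering map `p : E → X` with `X` simply
  connected and locally path connected and `E` preconnected and nonempty is bijective: the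
  identity of `X` lifts to a section `s` (monodromy theorem,
  `IsCoveringMap.existsUnique_continuousMap_lifts`), and `s ∘ p = id` by uniqueness of lifts on
  the preconnected `E` (`IsCoveringMap.eq_of_comp_eq`);
* `IsCoveringMap.isHomeomorph_of_simplyConnectedSpace` — hence `p` is a homeomorphism (a
  bijective local homeomorphism).

Theorems only; no definitions, no named facts.

## References

* A. Hatcher, *Algebraic Topology*, CUP 2002, §1.3, Prop. 1.34 (unique lifting) and Prop. 1.39.
* R. Beig, P. T. Chruściel, J. Math. Phys. 37 (1996) 1939–1961, §4 (proof of Thm. 4.1).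
-/

open Set Function Topology

namespace Literature.Topology.CoveringSpaces

variable {E X : Type*} [TopologicalSpace E] [TopologicalSpace X] {p : E → X}

/-- **A connected covering of a simply connected space is a bijection.** For a covering map
`p : E → X` with `X` simply connected and locally path connected and `E` preconnected and
nonempty: the identity of `X` lifts to a continuous section `s` with `p ∘ s = id`, and
`s ∘ p = id` because both sides lift `p` through `p` and agree at one point (uniqueness of lifts
from a preconnected space). Hatcher 2002, Prop. 1.39 with Prop. 1.34.
[cite: Hatcher2002, Prop. 1.34 and Prop. 1.39] -/
theorem IsCoveringMap.bijective_of_simplyConnectedSpace (hp : IsCoveringMap p)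
    [SimplyConnectedSpace X] [LocallyPathConnectedSpace X] [PreconnectedSpace E] [Nonempty E] :
    Bijective p := by
  obtain ⟨e₀⟩ := ‹Nonempty E›
  obtain ⟨s, ⟨hs₀, hps⟩, -⟩ :=
    hp.existsUnique_continuousMap_lifts (ContinuousMap.id X) (p e₀) e₀ rfl
  have hps' : ∀ x, p (s x) = x := fun x ↦ congr_fun hps x
  have hsp : (s ∘ p : E → E) = id :=
    hp.eq_of_comp_eq (s.continuous.comp hp.continuous) continuous_id
      (funext fun e ↦ hps' (p e)) e₀ hs₀
  refine ⟨fun e e' h ↦ ?_, fun x ↦ ⟨s x, hps' x⟩⟩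
  have he : s (p e) = e := congr_fun hsp e
  have he' : s (p e') = e' := congr_fun hsp e'
  rw [← he, ← he', h]

/-- **A connected covering of a simply connected space is a homeomorphism** (a bijective local
homeomorphism: continuous, open, bijective). Hatcher 2002, Prop. 1.39.
[cite: Hatcher2002, Prop. 1.39] -/
theorem IsCoveringMap.isHomeomorph_of_simplyConnectedSpace (hp : IsCoveringMap p)
    [SimplyConnectedSpace X] [LocallyPathConnectedSpace X] [PreconnectedSpace E] [Nonempty E] :
    IsHomeomorph p :=
  ⟨hp.continuous, hp.isLocalHomeomorph.isOpenMap,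
    IsCoveringMap.bijective_of_simplyConnectedSpace hp⟩

end Literature.Topology.CoveringSpaces
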